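import Summits.Ventures.PercRepro.ProfileMixedStepClean

/-!
# PercRepro — the inductive step of `MAS` with DROPPED members (p10, gen 0; S5, Proposition 2″)

`ProfileMixedStepClean.lean` closes the inductive step of the mixed-antichain profile-Hall form `MAS` when a non-loop
`e` is CLEAN for the antichain `𝒜`.  When `e` is not clean, the family `𝒜₁ = {B ∖ {e} : B ∈ 𝒜}` has non-minimal
members — exactly the DROPPED members `B ∌ e` that contain `B′ ∖ {e}` for some member `B′ ∋ e` — and the contraction
hypothesis can only be applied to the minimal members of `𝒜₁` (`minimals`, `shadowLevel_minimals`,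
`minimals_antichain`).  A dropped member is then paid by the deletion side alone, which suffices exactly when
`e ∈ cl(E − e − B)` (`pi_delete_eq_of_mem_closure`: the `M ＼ {e}`-price equals the `M`-price).  Hence:

* **`mas_step_of_dropped_mem_closure`** — if every dropped member `B` has `e ∈ cl(E − e − B)`, the inequality for
  `(M, 𝒜, u)` follows from `MAS (M ＼ {e}) u` and `MAS (M ／ {e}) (u − 1)`; Proposition 2⁺ is the case of no
  dropped member.
What the induction hypotheses cannot pay, for any `e`: a dropped member `B` with `e ∉ cl(E − e − B)` (`e` a coloop of
`M|(E ∖ B)`) — the tight families (all `q`-subsets of a free matroid) have such a member for every `e` (S5 §4).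
-/

/-! ## The step with DROPPED members: Proposition 2″ -/

open scoped Matroid

namespace PercRepro.Skew

open Finset ThmH Shadow Profile

variable {α : Type} [DecidableEq α] {M : Matroid α} [M.Finite] {e : α} {u : ℕ}

/-- If `e ∈ cl(E − e − B)` (`ε = 0`), the price of `B ∌ e` in `M ＼ {e}` is its price in `M`. -/
theorem pi_delete_eq_of_mem_closure (he : M.Indep {e}) {B : Finset α} (hB : B ⊆ gr M) (heB : e ∉ B)
    (hε : e ∈ clF M ((gr M \ B).erase e)) : pi (M ＼ ({e} : Set α)) u B = pi M u B := by
  have heE : e ∈ gr M := mem_gr_of_indep he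
  have hB' : B ⊆ (gr M).erase e := Finset.subset_erase.2 ⟨hB, heB⟩
  have heC : e ∈ gr M \ B := Finset.mem_sdiff.2 ⟨heE, heB⟩
  have hC' : (gr M \ B).erase e ⊆ (gr M).erase e := Finset.erase_subset_erase e Finset.sdiff_subset
  have hCg : (gr M \ B).erase e ⊆ gr M := hC'.trans (Finset.erase_subset e _)
  have hpp : rk M (gr M \ B) = rk M ((gr M \ B).erase e) := by
    conv_lhs => rw [← Finset.insert_erase heC]
    rw [rk_insert_eq heE hCg, if_pos hε]
  unfold pi
  rw [rk_delete hB', gr_delete', erase_sdiff, rk_delete hC', hpp]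

/-- The minimal members of a family. -/
noncomputable def minimals (𝒜 : Finset (Finset α)) : Finset (Finset α) :=
  𝒜.filter (fun T => ∀ T' ∈ 𝒜, T' ⊆ T → T' = T)

/-- Every member of a family contains a minimal member. -/
theorem exists_minimal_subset (𝒜 : Finset (Finset α)) {T : Finset α} (hT : T ∈ 𝒜) :
    ∃ T₀ ∈ minimals 𝒜, T₀ ⊆ T := by
  -- take a member of minimum cardinality among those contained in `T`
  classical
  obtain ⟨T₀, hT₀, hmin⟩ := Finset.exists_min_image (𝒜.filter (fun T' => T' ⊆ T)) Finset.card
    ⟨T, Finset.mem_filter.2 ⟨hT, Finset.Subset.refl _⟩⟩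
  rw [Finset.mem_filter] at hT₀
  refine ⟨T₀, ?_, hT₀.2⟩
  unfold minimals
  rw [Finset.mem_filter]
  refine ⟨hT₀.1, fun T' hT' hsub => ?_⟩
  have h := hmin T' (Finset.mem_filter.2 ⟨hT', hsub.trans hT₀.2⟩)
  exact Finset.eq_of_subset_of_card_le hsub h

/-- The shadow of a family is the shadow of its minimal members. -/
theorem shadowLevel_minimals (𝒜 : Finset (Finset α)) : shadowLevel M u (minimals 𝒜) = shadowLevel M u 𝒜 := by
  ext S
  rw [mem_shadowLevel, mem_shadowLevel]
  constructor
  · rintro ⟨hS, T, hT, hTS⟩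
    exact ⟨hS, T, (Finset.mem_filter.1 hT).1, hTS⟩
  · rintro ⟨hS, T, hT, hTS⟩
    obtain ⟨T₀, hT₀, hT₀T⟩ := exists_minimal_subset 𝒜 hT
    exact ⟨hS, T₀, hT₀, hT₀T.trans hTS⟩

/-- The minimal members form an antichain. -/
theorem minimals_antichain (𝒜 : Finset (Finset α)) :
    ∀ T ∈ minimals 𝒜, ∀ T' ∈ minimals 𝒜, T ⊆ T' → T = T' := by
  intro T hT T' hT' hTT'
  unfold minimals at hT hT'
  rw [Finset.mem_filter] at hT hT'
  exact hT'.2 T hT.1 hTT'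

/-- **Proposition 2″**: for a non-loop `e` and an antichain `𝒜`, let `D` be the DROPPED members — `B ∌ e` containing
`B′ ∖ {e}` for some member `B′ ∋ e`.  If every dropped member has `e ∈ cl(E − e − B)`, the inequality for
`(M, 𝒜, u)` follows from `MAS (M ＼ {e}) u` and `MAS (M ／ {e}) (u − 1)`.  (Proposition 2⁺ is the case `D = ∅`.) -/
theorem mas_step_of_dropped_mem_closure (he : M.Indep {e}) (hu : 1 ≤ u) (h1 : MAS (M ＼ ({e} : Set α)) u)
    (h2 : MAS (M ／ ({e} : Set α)) (u - 1)) (𝒜 : Finset (Finset α)) (h𝒜 : ∀ B ∈ 𝒜, B ⊆ gr M)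
    (hanti : ∀ B ∈ 𝒜, ∀ B' ∈ 𝒜, B ⊆ B' → B = B')
    (hdrop : ∀ B ∈ 𝒜, e ∉ B → (∃ B' ∈ 𝒜, e ∈ B' ∧ B'.erase e ⊆ B) → e ∈ clF M ((gr M \ B).erase e)) :
    ∑ B ∈ 𝒜, pi M u B ≤ ((shadowLevel M u 𝒜).card : ℚ) := by
  set 𝒜₀ := 𝒜.filter (fun B => e ∉ B) with h𝒜₀
  set 𝒜₁ := 𝒜.image (fun B => B.erase e) with h𝒜₁
  have hinj : Set.InjOn (fun B => B.erase e) (𝒜 : Set (Finset α)) := injOn_erase_of_antichain 𝒜 hanti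
  -- the deletion hypothesis on `𝒜₀`, the contraction hypothesis on the minimal members of `𝒜₁`
  have hd := h1 𝒜₀
    (fun B hB => by
      rw [gr_delete']
      exact Finset.subset_erase.2 ⟨h𝒜 B (Finset.mem_filter.1 hB).1, (Finset.mem_filter.1 hB).2⟩)
    (fun B hB B' hB' hBB' => hanti B (Finset.mem_filter.1 hB).1 B' (Finset.mem_filter.1 hB').1 hBB')
  have hc := h2 (minimals 𝒜₁)
    (fun B' hB' => by
      have hB'' := (Finset.mem_filter.1 hB').1
      rw [h𝒜₁, Finset.mem_image] at hB''
      obtain ⟨B, hB, rfl⟩ := hB''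
      rw [gr_contract']
      exact Finset.erase_subset_erase e (h𝒜 B hB))
    (minimals_antichain 𝒜₁)
  rw [shadowLevel_minimals] at hc
  -- the shadow split
  have hsplit : (shadowLevel M u 𝒜).card =
      (shadowLevel (M ＼ ({e} : Set α)) u 𝒜₀).card + (shadowLevel (M ／ ({e} : Set α)) (u - 1) 𝒜₁).card := by
    rw [← Finset.card_filter_add_card_filter_not (s := shadowLevel M u 𝒜) (fun S => e ∉ S),
      shadowLevel_filter_notMem, shadowLevel_delete_filter, ← card_shadowLevel_filter_mem he hu 𝒜]
    congr 2
    ext S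
    simp only [Finset.mem_filter, not_not]
  -- the contraction sum over the minimal members is a sum over 𝒜 with the non-minimal (dropped) members weighted 0
  have hmin_iff : ∀ B ∈ 𝒜, B.erase e ∈ minimals 𝒜₁ ↔
      (e ∈ B ∨ ¬ ∃ B' ∈ 𝒜, e ∈ B' ∧ B'.erase e ⊆ B) := by
    intro B hB
    unfold minimals
    rw [Finset.mem_filter]
    constructor
    · rintro ⟨-, hm⟩
      by_cases heB : e ∈ B
      · exact Or.inl heB
      · refine Or.inr ?_
        rintro ⟨B', hB', heB', hsub⟩
        have hsub' : B'.erase e ⊆ B.erase e := by rw [Finset.erase_eq_of_notMem heB]; exact hsub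
        have heq := hm (B'.erase e) (Finset.mem_image_of_mem _ hB') hsub'
        -- then B' ∖ e = B, so B' ⊋ B (e ∈ B' ∖ B): contradicts the antichain
        rw [Finset.erase_eq_of_notMem heB] at heq
        have : B ⊆ B' := by rw [← heq]; exact Finset.erase_subset e B'
        have hBB' := hanti B hB B' hB' this
        subst hBB'
        exact heB heB'
    · intro h
      refine ⟨Finset.mem_image_of_mem _ hB, fun T' hT' hsub => ?_⟩
      rw [h𝒜₁, Finset.mem_image] at hT'
      obtain ⟨B', hB', rfl⟩ := hT'
      rcases h with heB | hnd
      · -- e ∈ B: B' ∖ e ⊆ B ∖ e; if e ∈ B' then B' ⊆ B so B' = B; if e ∉ B' then B' ⊆ B ∖ e ⊊ B, B' = B impossible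
        by_cases heB' : e ∈ B'
        · have : B' ⊆ B := by
            intro x hx
            by_cases hxe : x = e
            · subst hxe; exact heB
            · exact Finset.mem_of_mem_erase (hsub (Finset.mem_erase.2 ⟨hxe, hx⟩))
          rw [hanti B' hB' B hB this]
        · rw [Finset.erase_eq_of_notMem heB'] at hsub ⊢
          have : B' ⊆ B := hsub.trans (Finset.erase_subset e B)
          have hBB := hanti B' hB' B hB this
          subst hBB
          exact absurd heB heB'
      · -- e ∉ B (B not dropped): B' ∖ e ⊆ B; if e ∈ B' this is a drop witness; if e ∉ B' then B' ⊆ B so B' = B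
        have heB : e ∉ B := by
          intro heB
          exact hnd ⟨B, hB, heB, Finset.erase_subset e B⟩
        rw [Finset.erase_eq_of_notMem heB] at hsub ⊢
        by_cases heB' : e ∈ B'
        · exact absurd ⟨B', hB', heB', hsub⟩ hnd
        · rw [Finset.erase_eq_of_notMem heB'] at hsub ⊢
          rw [hanti B' hB' B hB hsub]
  have hsum₁ : ∑ T ∈ minimals 𝒜₁, pi (M ／ ({e} : Set α)) (u - 1) T =
      ∑ B ∈ 𝒜, (if B.erase e ∈ minimals 𝒜₁ then pi (M ／ ({e} : Set α)) (u - 1) (B.erase e) else 0) := by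
    rw [← Finset.sum_filter]
    have himg : minimals 𝒜₁ = (𝒜.filter (fun B => B.erase e ∈ minimals 𝒜₁)).image (fun B => B.erase e) := by
      ext T
      constructor
      · intro hT
        have hT' := (Finset.mem_filter.1 hT).1
        rw [h𝒜₁, Finset.mem_image] at hT'
        obtain ⟨B, hB, rfl⟩ := hT'
        exact Finset.mem_image_of_mem _ (Finset.mem_filter.2 ⟨hB, hT⟩)
      · intro hT
        rw [Finset.mem_image] at hT
        obtain ⟨B, hB, rfl⟩ := hT
        exact (Finset.mem_filter.1 hB).2
    conv_lhs => rw [himg]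
    exact Finset.sum_image (hinj.mono (by intro B hB; exact (Finset.mem_filter.1 hB).1))
  have hsum₀ : ∑ B ∈ 𝒜₀, pi (M ＼ ({e} : Set α)) u B =
      ∑ B ∈ 𝒜, (if e ∈ B then 0 else pi (M ＼ ({e} : Set α)) u B) := by
    rw [h𝒜₀, Finset.sum_filter]
    apply Finset.sum_congr rfl
    intro B _
    split_ifs <;> rfl
  -- every member is paid
  have hpay : ∀ B ∈ 𝒜, pi M u B ≤ (if e ∈ B then 0 else pi (M ＼ ({e} : Set α)) u B) +
      (if B.erase e ∈ minimals 𝒜₁ then pi (M ／ ({e} : Set α)) (u - 1) (B.erase e) else 0) := by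
    intro B hB
    by_cases heB : e ∈ B
    · rw [if_pos heB, if_pos ((hmin_iff B hB).2 (Or.inl heB)), zero_add]
      exact pi_le_contract_erase he hu (h𝒜 B hB) heB
    · rw [if_neg heB]
      by_cases hdr : ∃ B' ∈ 𝒜, e ∈ B' ∧ B'.erase e ⊆ B
      · -- dropped: paid by the deletion price alone (ε = 0)
        have hnm : B.erase e ∉ minimals 𝒜₁ := fun h => by
          rcases (hmin_iff B hB).1 h with h' | h'
          · exact heB h'
          · exact h' hdr
        rw [if_neg hnm, add_zero, pi_delete_eq_of_mem_closure he (h𝒜 B hB) heB (hdrop B hB heB hdr)]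
      · rw [if_pos ((hmin_iff B hB).2 (Or.inr hdr)), Finset.erase_eq_of_notMem heB]
        exact pi_le_delete_add_contract he hu (h𝒜 B hB) heB
  rw [hsplit, Nat.cast_add]
  calc ∑ B ∈ 𝒜, pi M u B
      ≤ ∑ B ∈ 𝒜, ((if e ∈ B then 0 else pi (M ＼ ({e} : Set α)) u B) +
          (if B.erase e ∈ minimals 𝒜₁ then pi (M ／ ({e} : Set α)) (u - 1) (B.erase e) else 0)) :=
        Finset.sum_le_sum hpay
    _ = ∑ B ∈ 𝒜₀, pi (M ＼ ({e} : Set α)) u B + ∑ T ∈ minimals 𝒜₁, pi (M ／ ({e} : Set α)) (u - 1) T := by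
        rw [Finset.sum_add_distrib, hsum₀, hsum₁]
    _ ≤ _ := add_le_add hd hc

end PercRepro.Skew
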